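import Summits.QuantumFields.BalabanUV.T4Continuum.Support.VariationalColourTaxiTowerEndMin
import Summits.QuantumFields.BalabanUV.T4Continuum.Support.VariationalColourTaxiTowerLandau
import Summits.QuantumFields.BalabanUV.T4Continuum.Support.VariationalVectorEndMonotone

/-!
# T⁴ programme, spine node NE2 (U1a), lane P2 — «V-COL-TAXI-END», part 5: THE MONOTONE END AT BAŁABAN's TAXI DATA — EXISTENCE of the vector tower limit
# (leaf-10-g3's `VariationalVectorEndMonotone.effV_tendsto_of_upper_geom`, p226720: from the UPPER bracket alone, no slice law, no Federbush, no rate) at the nested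
# product line transports of a COHERENT tower of UNITARY one-step bond operators under the scale-invariant plaquette class; for the Feynman–Landau functional
# (`δ = 1`) EXISTENCE ⇐ (ONE-min) ALONE

NE2 formalisation swarm `b2b-balaban-t4-ne2-formalise-*`, leaf prover 04 GEN 5 (`prover-b2b-balaban-t4-ne2-formalise-leaf-04-g5-0`); register row «P2-sup» of
`t4/formal/NE2/LEAVES.md`; journal CLAIMS.log «V-COL-TAXI-END» part 5 (offered 2026-08-20 16:12Z l.16895, INTENT part 4 §3 l.17146).  Compositions BY NAME of leaf-10-g3's
`VariationalVectorEndMonotone.effV_tendsto_of_upper_geom` (p226720) with parts 1–4 of «V-COL-TAXI-END» (`taxiClassPackage`, the Landau sockets `hUBc_landau_nestLv` ∕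
`hPc_landau_nestLv`), parts 9 ∕ 10 of «V-COL-TAXI-TOWER» ((E_k) `nestLv_sub_lineT_le`, `exists_ubV_nestLv_ScV`, `qWV_le_nestLv_of_garding`, `inBlock_blockOf_of_bpt`) and leaf-03-g5's
`VariationalVectorRegularityNear.hREG_rhoV_landau_near` (p224635); nothing defined.

THE POINT.  p226720 needs, per level, ONLY coarse V-UB, coarse V-P, (ONE-min) and V-REG (+ the structural binders) and concludes that the Hermitian effective 1-form actions
CONVERGE (no rate).  At Bałaban's taxi data coarse V-UB ∕ V-P are parts 10's theorems (modulo the displayed (GF1′) ∕ Gårding constants of `G`), uniform under the class by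
part 4's `taxiClassPackage`; so:
 * §1 **`effV_tendsto_taxiTower_of_class`**: for ANY gauge-functional tower `G` with matrix form, `Gtr`-compatibility, (GF1′) (`C_G,k ≤ C_G⋆`, `(L^k)²C₀,k ≤ c₀`) and a Gårding half
   (`κ_k ≤ κ⋆`, `κ′_k ≤ κ′⋆`): `∃ X∞, effV (L^k) M (Rlev k) (Gm k) (QmL (L^k) M (nestLv k)) a → X∞` (Hermitian, nonnegative form, block-spin values converge) ⇐ **(ONE-min)_k + V-REG_k**
   with geometric `ε₁`, `δ′` — DISPLAYED, nothing else; class `(L^{k+1})²b_k ≤ c` + part 2's three smallness conditions on `c`;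
 * §2 **`effV_tendsto_taxiTower_landau_one_of_class`**: for the Feynman–Landau functional `landauG 1 (Rlev k)` the G-side AND V-REG are theorems (part 3 §1, leaf-03-g5's (G)), so
   EXISTENCE of the limit ⇐ **(ONE-min)_k ALONE** (displayed, with `ρV k = rhoV (L^k) M (Rlev k)`, geometric `ε₁`, `δ′`; class + `80·d·c ≤ 1`).
HONEST, UP FRONT: (ONE-min) with background is OPEN — it is leaf V-ONE's curl half (landed at taxi data for every field, gen 4 part 5 `blockSpin_lineT_taxi_le`) PLUS a fine-level
law bounding the gauge functional `G′` of that competitor inside the composite fibre (leaf-01-g7's memo `t4/T4-EST-NE2-P2-VGF.md` (V5)); for `landauG` it is NOT expected to hold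
(N-ne2leaf01g6-1).  What this file settles: at CURVED data the EXISTENCE half of the vector END has exactly ONE open analytic input beyond V-REG.

HONEST FRAMING (T4-DAG p. 1).  Composition at MODEL level (`E = ℂ`; bond operators DATA; taxi ∕ straight contours OURS; SHAPES only, no B0, c5); Landau is a model inhabitant,
NOT Bałaban's `G`; nothing printed is a hypothesis; no `def`, no `def … : Prop`, no `sorry`; axioms standard.  V-GF ((ONE-min), (GF1′), Gårding) ∕ V-REG DISPLAYED in §1 ⟹ V-END
with background NOT proved; NE2 NOT proved on either road; NE3 OPEN; spine PROVED 0∕9 unchanged; rung (B)+1 finite T⁴ — NOT infinite volume, NOT mass gap, NOT Clay.  HONEST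
DEPENDENCY (cell, verbatim): continuum YM on T⁴ ⇐ BetaPertH ∧ nine spine estimates (0/9 proved); BetaPertH ⇐ (D1) ∧ (D4) ∧ CAP+tail; G-an2-4 gates asym, D1 and NE2/3/4.
-/

noncomputable section

namespace Summit.QuantumFields.BalabanUV.T4Continuum.VariationalColourTaxiTransport

open Finset Filter
open scoped Matrix ComplexOrder BigOperators Topology
open Literature.MathematicalPhysics.QuantumFieldTheory.Balaban1983to89.B5Prop11Plancherel (Tor fine unitVec)
open Literature.Analysis.Complex (qform)
open Summit.QuantumFields.BalabanUV.T4Continuum.VariationalTransfer (blockSpin)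
open Summit.QuantumFields.BalabanUV.T4Continuum.VariationalColourFederbush (norm_le_one_of_mem_unitary)
open Summit.QuantumFields.BalabanUV.T4Continuum.VariationalColourTower (Rtrv)
open Summit.QuantumFields.BalabanUV.T4Continuum.VariationalVectorFederbush (lineT)
open Summit.QuantumFields.BalabanUV.T4Continuum.VectorBlockTrialForm (nsqV nsqV_nonneg QvL roughV kappaV)
open Summit.QuantumFields.BalabanUV.T4Continuum.VariationalVectorForm (ScV SfV qWV lamV lamV_nonneg ScV_nonneg)
open Summit.QuantumFields.BalabanUV.T4Continuum.VariationalVectorEffective (unc effV)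
open Summit.QuantumFields.BalabanUV.T4Continuum.VariationalVectorTower (Gtr QmL)
open Summit.QuantumFields.BalabanUV.T4Continuum.VariationalVectorEndOfLeaves (nonneg_of_qform)
open Summit.QuantumFields.BalabanUV.T4Continuum.VariationalVectorGarding (landauG landauG_nonneg)
open Summit.QuantumFields.BalabanUV.T4Continuum.VariationalVectorLandauTower (KLandau KLandau_posSemidef landauG_eq_qform landauG_hGtr)
open Summit.QuantumFields.BalabanUV.T4Continuum.VariationalVectorOneStepPhys (rhoV rhoV_nonneg)
open Summit.QuantumFields.BalabanUV.T4Continuum.VariationalVectorRegularityNear (hREG_rhoV_landau_near)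
open Summit.QuantumFields.BalabanUV.T4Continuum.VariationalVectorEndMonotone (effV_tendsto_of_upper_geom)

variable {d : ℕ}
variable (L : ℕ) [NeZero L] (M : Fin d → ℕ) [hM : ∀ μ, NeZero (M μ)]
variable {R' : (k : ℕ) → Tor (fine L (fine (L ^ k) M)) → Fin d → (ℂ →L[ℂ] ℂ)}

/-! ## §1 Existence of the vector tower limit at taxi data, any gauge-functional tower: ⇐ (ONE-min) + V-REG -/

section AnyG

variable (Gm : (k : ℕ) → Matrix (Tor (fine (L ^ k) M) × Fin d) (Tor (fine (L ^ k) M) × Fin d) ℂ)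
variable (G : (k : ℕ) → (Tor (fine (L ^ k) M) → Fin d → ℂ) → ℝ)
variable (G' : (k : ℕ) → (Tor (fine L (fine (L ^ k) M)) → Fin d → ℂ) → ℝ)

/-- **THE MONOTONE END AT BAŁABAN's TAXI DATA (any gauge-functional tower).**  `2 ≤ L`, `1 ≤ d`, `1 < M_μ`; a COHERENT tower of UNITARY one-step bond operators in the class
`(L^{k+1})²b_k ≤ c` with part 2's three polynomial smallness conditions on `c`; the G-side DISPLAYED (matrix form, `Gtr`, (GF1′) with `C_G,k ≤ C_G⋆`, `(L^k)²C₀,k ≤ c₀`, Gårding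
`κ_k ≤ κ⋆`, `0 ≤ κ′_k ≤ κ′⋆`); (ONE-min)_k and V-REG_k DISPLAYED with `ε₁ k ≤ c_εθ^k`, `δ′ k ≤ c_δ′θ^k`, `C_R k ≤ C_R⋆`, `0 ≤ θ < 1`.  THEN the effective 1-form actions
`effV (L^k) M (Rlev k) (Gm k) (QmL (L^k) M (nestLv k)) a` CONVERGE to a Hermitian matrix with nonnegative form, and the block-spin values converge to its form — coarse V-UB ∕ V-P
DISCHARGED (part 10 + `taxiClassPackage`), NO slice law, NO Federbush, NO rate (`aa` = p226720's parameter `a`). [folklore] -/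
theorem effV_tendsto_taxiTower_of_class (hL : 2 ≤ L) (hd : 1 ≤ d) (hM2 : ∀ μ, 1 < M μ)
    (hU : ∀ k x μ, R' k x μ ∈ unitary (ℂ →L[ℂ] ℂ)) {b : ℕ → ℝ} {c : ℝ}
    (hb : ∀ k x κ ι, ‖R' k x κ * R' k (x + unitVec (fine L (fine (L ^ k) M)) κ) ι - R' k x ι * R' k (x + unitVec (fine L (fine (L ^ k) M)) ι) κ‖ ≤ b k)
    (hbc : ∀ k, (((L ^ (k + 1) : ℕ)) : ℝ) ^ 2 * b k ≤ c)
    (hcoh : ∀ k, coarseTv L (fine (L ^ (k + 1)) M) (R' (k + 1)) = Rtrv (L ^ k) L M (R' k))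
    (hsm1 : 60 * (6 : ℝ) ^ (d - 1) * ((2 * ((((d - 1 : ℕ) : ℝ) + (d : ℝ) * d)) + 3 * ((d - 1 : ℕ) : ℝ)) * c) ≤ 1 / 2)
    (hsm2 : 2 * (d : ℝ) * ((((d - 1 : ℕ) : ℝ)) * c) ^ 2 ≤ 1 / 2) (hsm3 : 64 * (2 * ((((d - 1 : ℕ) : ℝ) + (d : ℝ) * d) * c)) ^ 2 ≤ 1)
    -- the G-side (leaf V-GF, DISPLAYED)
    (hGm : ∀ k, (Gm k).PosSemidef) (hG : ∀ k W, G k W = qform (Gm k) (unc W)) (hGtr : ∀ k, G (k + 1) = Gtr (L ^ k) L M (G' k))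
    {CG C₀ κg κg' : ℕ → ℝ} {CGs c₀ κs κs' : ℝ} (hCG : ∀ k, 0 ≤ CG k) (hCGs : ∀ k, CG k ≤ CGs) (hC₀ : ∀ k, 0 ≤ C₀ k)
    (hC₀c : ∀ k, (((L ^ k : ℕ)) : ℝ) ^ 2 * C₀ k ≤ c₀) (hκg' : ∀ k, 0 ≤ κg' k) (hκs : ∀ k, κg k ≤ κs) (hκs' : ∀ k, κg' k ≤ κs')
    (hGF : ∀ k W, G k W ≤ CG k * roughV (L ^ k) M (Rlev L M R' k) W + C₀ k * nsqV (fine (L ^ k) M) W)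
    (hGar : ∀ k W, ((((L ^ k : ℕ) : ℝ)) ^ d)⁻¹ * ((((L ^ k : ℕ) : ℝ)) ^ 2 * roughV (L ^ k) M (Rlev L M R' k) W)
      ≤ κg k * ScV (L ^ k) M (Rlev L M R' k) (G k) W + κg' k * nsqV M (QvL (L ^ k) M (nestLv L M R' k) W))
    -- the effective-operator parameter, the decay rate and the DISPLAYED leaves (ONE-min), V-REG
    {aa : ℝ} (haa : 0 < aa) {θ : ℝ} (hθ : 0 ≤ θ) (hθ1 : θ < 1)
    (CR ε₁ δ' : ℕ → ℝ) {CRs cε cδ' : ℝ} (hCR : ∀ k, 0 ≤ CR k) (hCRs : ∀ k, CR k ≤ CRs) (hε₁ : ∀ k, 0 ≤ ε₁ k) (hδ' : ∀ k, 0 ≤ δ' k)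
    (hεθ : ∀ k, ε₁ k ≤ cε * θ ^ k) (hδ'θ : ∀ k, δ' k ≤ cδ' * θ ^ k)
    {ρV : (k : ℕ) → (Tor (fine (L ^ k) M) → Fin d → ℂ) → ℝ} (hρ0 : ∀ k W, 0 ≤ ρV k W)
    (hONEm : ∀ k (φ : Tor M → Fin d → ℂ) (W₀ : Tor (fine (L ^ k) M) → Fin d → ℂ), QvL (L ^ k) M (nestLv L M R' k) W₀ = φ →
      (∀ W, QvL (L ^ k) M (nestLv L M R' k) W = φ → ScV (L ^ k) M (Rlev L M R' k) (G k) W₀ ≤ ScV (L ^ k) M (Rlev L M R' k) (G k) W) →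
      ∃ g, QvL (L ^ k) M (nestLv L M R' k) (QvL L (fine (L ^ k) M) (lineT L (fine (L ^ k) M) (taxiTv L (fine (L ^ k) M) (R' k)) (R' k)) g) = φ ∧
        SfV (L ^ k) L M (R' k) (G' k) g ≤ (Real.sqrt (ScV (L ^ k) M (Rlev L M R' k) (G k) W₀ + ε₁ k * ρV k W₀) + δ' k * Real.sqrt (qWV (L ^ k) M W₀)) ^ 2)
    (hREG : ∀ k (φ : Tor M → Fin d → ℂ) W, QvL (L ^ k) M (nestLv L M R' k) W = φ →
      (∀ W₂, QvL (L ^ k) M (nestLv L M R' k) W₂ = φ → ScV (L ^ k) M (Rlev L M R' k) (G k) W ≤ ScV (L ^ k) M (Rlev L M R' k) (G k) W₂) →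
      ρV k W ≤ CR k * (ScV (L ^ k) M (Rlev L M R' k) (G k) W + nsqV M φ)) :
    ∃ Xlim : Matrix (Tor M × Fin d) (Tor M × Fin d) ℂ,
      Tendsto (fun k => effV (L ^ k) M (Rlev L M R' k) (Gm k) (QmL (L ^ k) M (nestLv L M R' k)) aa) atTop (𝓝 Xlim) ∧ Xlim.IsHermitian ∧ (∀ v, 0 ≤ qform Xlim v) ∧
      ∀ φ : Tor M → Fin d → ℂ,
        Tendsto (fun k => blockSpin (QvL (L ^ k) M (nestLv L M R' k)) (ScV (L ^ k) M (Rlev L M R' k) (G k)) φ) atTop (𝓝 (qform Xlim (unc φ))) := by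
  have hG0 : ∀ k W, 0 ≤ G k W := fun k => nonneg_of_qform (L ^ k) M (hGm k) (hG k)
  obtain ⟨a, ha0, ha, -, hκγ, hsmallP, hγs, -, hΛk⟩ := taxiClassPackage L M hL hd hU hb hbc hsm1 hsm2 hsm3 hCG hCGs hC₀ hC₀c
  -- uniform constants
  set Λs : ℝ := 4 * lamV d (((d - 1 : ℕ) : ℝ) * c) CGs c₀ with hΛsdef
  set CPs : ℝ := max (40 * κs) (64 + 40 * κs') with hCPsdef
  have hΛs0 : 0 ≤ Λs := le_trans (div_nonneg (lamV_nonneg (hCG 0) (by have := hC₀ 0; positivity)) (sq_nonneg _)) (hΛk 0)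
  have hCPk : ∀ k, max (40 * κg k) (64 + 40 * κg' k) ≤ CPs := fun k => max_le_max (by linarith [hκs k]) (by linarith [hκs' k])
  have hCPs0 : 0 ≤ CPs := le_trans (le_max_of_le_right (by linarith [hκg' 0])) (hCPk 0)
  -- coarse V-UB ∕ V-P at taxi data (part 10), weakened to the uniform constants
  have hUBc : ∀ k (φ : Tor M → Fin d → ℂ), ∃ W, QvL (L ^ k) M (nestLv L M R' k) W = φ ∧ ScV (L ^ k) M (Rlev L M R' k) (G k) W ≤ Λs * nsqV M φ :=
    fun k φ => by
    obtain ⟨W, hW, hS⟩ := exists_ubV_nestLv_ScV L M hU hb hcoh k (ha0 k) (ha k) hd (lt_of_le_of_lt (hκγ k) (by norm_num)) (hCG k) (hC₀ k) (hGF k) φ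
    exact ⟨W, hW, hS.trans (mul_le_mul_of_nonneg_right (hΛk k) (nsqV_nonneg M φ))⟩
  have hPc : ∀ k W, qWV (L ^ k) M W ≤ CPs * (ScV (L ^ k) M (Rlev L M R' k) (G k) W + nsqV M (QvL (L ^ k) M (nestLv L M R' k) W)) := fun k W => by
    have h := qWV_le_nestLv_of_garding L M hU hb hcoh hM2 k (ha k) (hsmallP k) (hγs k) (hG0 k) (hGar k) W
    exact h.trans (mul_le_mul_of_nonneg_right (hCPk k) (add_nonneg (ScV_nonneg (L ^ k) M _ (hG0 k) W) (nsqV_nonneg M _)))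
  exact effV_tendsto_of_upper_geom L M (Rlev L M R') R' Gm G G' (nestLv L M R')
    (fun k => lineT L (fine (L ^ k) M) (taxiTv L (fine (L ^ k) M) (R' k)) (R' k)) hGm hG (fun k => rfl) (fun k => rfl) hGtr haa
    (fun _ => Λs) (fun _ => CPs) CR ε₁ δ' (fun _ => hΛs0) (fun _ => le_rfl) (fun _ => hCPs0) (fun _ => le_rfl) hCR hCRs hε₁ hδ' hθ hθ1 hεθ hδ'θ
    hρ0 hUBc hPc hONEm hREG

end AnyG

/-! ## §2 The Feynman–Landau functional: existence of the limit ⇐ (ONE-min) alone -/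

section Landau

/-- **THE MONOTONE END AT BAŁABAN's TAXI DATA FOR THE FEYNMAN–LANDAU FUNCTIONAL (`δ = 1`): EXISTENCE ⇐ (ONE-min) ALONE.**  The G-side (matrix form `KLandau`, `landauG_hGtr`,
(GF1′) `landauG_le`, Gårding via (GF3)) and V-REG (leaf-03-g5's near-line `hREG_rhoV_landau_near`, `hnear` := (E_k)) are THEOREMS (part 3); coarse V-UB ∕ V-P are part 3 §1.
Class `(L^{k+1})²b_k ≤ c` + part 2's three smallness conditions + `80·d·c ≤ 1`; DISPLAYED: ONLY (ONE-min)_k for the full fine Landau form with `ρV k = rhoV (L^k) M (Rlev k)`,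
`ε₁ k ≤ c_εθ^k`, `δ′ k ≤ c_δ′θ^k` — NOT expected to be inhabited for `landauG` (N-ne2leaf01g6-1); the statement records that nothing ELSE is needed. [folklore] -/
theorem effV_tendsto_taxiTower_landau_one_of_class (hL : 2 ≤ L) (hd : 1 ≤ d) (hM2 : ∀ μ, 1 < M μ)
    (hU : ∀ k x μ, R' k x μ ∈ unitary (ℂ →L[ℂ] ℂ)) {b : ℕ → ℝ} {c : ℝ}
    (hb : ∀ k x κ ι, ‖R' k x κ * R' k (x + unitVec (fine L (fine (L ^ k) M)) κ) ι - R' k x ι * R' k (x + unitVec (fine L (fine (L ^ k) M)) ι) κ‖ ≤ b k)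
    (hbc : ∀ k, (((L ^ (k + 1) : ℕ)) : ℝ) ^ 2 * b k ≤ c)
    (hcoh : ∀ k, coarseTv L (fine (L ^ (k + 1)) M) (R' (k + 1)) = Rtrv (L ^ k) L M (R' k))
    (hsm1 : 60 * (6 : ℝ) ^ (d - 1) * ((2 * ((((d - 1 : ℕ) : ℝ) + (d : ℝ) * d)) + 3 * ((d - 1 : ℕ) : ℝ)) * c) ≤ 1 / 2)
    (hsm2 : 2 * (d : ℝ) * ((((d - 1 : ℕ) : ℝ)) * c) ^ 2 ≤ 1 / 2) (hsm3 : 64 * (2 * ((((d - 1 : ℕ) : ℝ) + (d : ℝ) * d) * c)) ^ 2 ≤ 1)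
    (hsm4 : 80 * ((d : ℝ) * c) ≤ 1)
    {aa : ℝ} (haa : 0 < aa) {θ : ℝ} (hθ : 0 ≤ θ) (hθ1 : θ < 1)
    (ε₁ δ' : ℕ → ℝ) {cε cδ' : ℝ} (hε₁ : ∀ k, 0 ≤ ε₁ k) (hδ' : ∀ k, 0 ≤ δ' k) (hεθ : ∀ k, ε₁ k ≤ cε * θ ^ k) (hδ'θ : ∀ k, δ' k ≤ cδ' * θ ^ k)
    (hONEm : ∀ k (φ : Tor M → Fin d → ℂ) (W₀ : Tor (fine (L ^ k) M) → Fin d → ℂ), QvL (L ^ k) M (nestLv L M R' k) W₀ = φ →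
      (∀ W, QvL (L ^ k) M (nestLv L M R' k) W = φ →
        ScV (L ^ k) M (Rlev L M R' k) (landauG (fine (L ^ k) M) 1 (Rlev L M R' k)) W₀ ≤ ScV (L ^ k) M (Rlev L M R' k) (landauG (fine (L ^ k) M) 1 (Rlev L M R' k)) W) →
      ∃ g, QvL (L ^ k) M (nestLv L M R' k) (QvL L (fine (L ^ k) M) (lineT L (fine (L ^ k) M) (taxiTv L (fine (L ^ k) M) (R' k)) (R' k)) g) = φ ∧
        SfV (L ^ k) L M (R' k) (landauG (fine L (fine (L ^ k) M)) 1 (R' k)) g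
          ≤ (Real.sqrt (ScV (L ^ k) M (Rlev L M R' k) (landauG (fine (L ^ k) M) 1 (Rlev L M R' k)) W₀ + ε₁ k * rhoV (L ^ k) M (Rlev L M R' k) W₀)
              + δ' k * Real.sqrt (qWV (L ^ k) M W₀)) ^ 2) :
    ∃ Xlim : Matrix (Tor M × Fin d) (Tor M × Fin d) ℂ,
      Tendsto (fun k => effV (L ^ k) M (Rlev L M R' k) (KLandau (fine (L ^ k) M) 1 (Rlev L M R' k)) (QmL (L ^ k) M (nestLv L M R' k)) aa) atTop (𝓝 Xlim) ∧
      Xlim.IsHermitian ∧ (∀ v, 0 ≤ qform Xlim v) ∧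
      ∀ φ : Tor M → Fin d → ℂ, Tendsto (fun k => blockSpin (QvL (L ^ k) M (nestLv L M R' k))
        (ScV (L ^ k) M (Rlev L M R' k) (landauG (fine (L ^ k) M) 1 (Rlev L M R' k))) φ) atTop (𝓝 (qform Xlim (unc φ))) := by
  have hR' : ∀ k x μ, ‖R' k x μ‖ ≤ 1 := fun k x μ => norm_le_one_of_mem_unitary (hU k x μ)
  -- the class package with the Landau (GF1′) constants `C_G = d∕1`, `C₀ = 0`
  obtain ⟨a, ha0, ha, hac, hκγ, hsmallP, hγs, -, hΛk⟩ := taxiClassPackage L M hL hd hU hb hbc hsm1 hsm2 hsm3 (CG := fun _ => (d : ℝ) / 1) (C₀ := fun _ => 0)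
    (CGs := (d : ℝ) / 1) (c₀ := 0) (fun _ => by positivity) (fun _ => le_rfl) (fun _ => le_rfl) (fun _ => by simp)
  have hcUB : ∀ k, (kappaV d (L ^ k))⁻¹ * ((∑ q ∈ Finset.range k, ((((d - 1 : ℕ) : ℝ) + (d : ℝ) * d) * (((L : ℝ) * ((L ^ q - 1 : ℕ) : ℝ) * ((L - 1 : ℕ) : ℝ)) * b q)))
      + 3 * (((d - 1 : ℕ) : ℝ) * (L ^ k : ℕ) * ((L ^ k - 1 : ℕ) : ℝ) * a k)) < 1 := fun k => lt_of_le_of_lt (hκγ k) (by norm_num)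
  have hsmallp : ∀ k, 80 * ((d : ℝ) * ((((L ^ k : ℕ) : ℝ)) ^ 2 * a k)) ≤ 1 := fun k => by
    nlinarith [mul_le_mul_of_nonneg_left (hac k) (Nat.cast_nonneg (α := ℝ) d)]
  have hsmall80 : ∀ k, 2 * 40 * ((d : ℝ) * ((((L ^ k : ℕ) : ℝ)) ^ 2 * a k)) ≤ 1 := fun k => by linarith [hsmallp k]
  -- uniform constants
  set Λs : ℝ := 4 * lamV d (((d - 1 : ℕ) : ℝ) * c) ((d : ℝ) / 1) 0 with hΛsdef
  set CPs : ℝ := max (40 * (2 * (1 + (1 : ℝ)))) (64 + 5120 * ((d : ℝ) * c)) with hCPsdef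
  have hΛk' : ∀ k, lamV d ((L ^ k : ℕ) * (((d - 1 : ℕ) : ℝ) * ((L ^ k - 1 : ℕ) : ℝ) * a k)) ((d : ℝ) / 1) (((L ^ k : ℕ) : ℝ) ^ 2 * 0)
      / (1 - (kappaV d (L ^ k))⁻¹ * ((∑ q ∈ Finset.range k, ((((d - 1 : ℕ) : ℝ) + (d : ℝ) * d) * (((L : ℝ) * ((L ^ q - 1 : ℕ) : ℝ) * ((L - 1 : ℕ) : ℝ)) * b q)))
          + 3 * (((d - 1 : ℕ) : ℝ) * (L ^ k : ℕ) * ((L ^ k - 1 : ℕ) : ℝ) * a k))) ^ 2 ≤ Λs := hΛk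
  have hΛk0 : ∀ k, 0 ≤ lamV d ((L ^ k : ℕ) * (((d - 1 : ℕ) : ℝ) * ((L ^ k - 1 : ℕ) : ℝ) * a k)) ((d : ℝ) / 1) (((L ^ k : ℕ) : ℝ) ^ 2 * 0)
      / (1 - (kappaV d (L ^ k))⁻¹ * ((∑ q ∈ Finset.range k, ((((d - 1 : ℕ) : ℝ) + (d : ℝ) * d) * (((L : ℝ) * ((L ^ q - 1 : ℕ) : ℝ) * ((L - 1 : ℕ) : ℝ)) * b q)))
          + 3 * (((d - 1 : ℕ) : ℝ) * (L ^ k : ℕ) * ((L ^ k - 1 : ℕ) : ℝ) * a k))) ^ 2 :=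
    fun k => div_nonneg (lamV_nonneg (by positivity) (by positivity)) (sq_nonneg _)
  have hΛs0 : 0 ≤ Λs := (hΛk0 0).trans (hΛk' 0)
  have hCPk : ∀ k, max (40 * (2 * (1 + (1 : ℝ)))) (64 + 40 * (2 * (0 + d * ((((L ^ k : ℕ) : ℝ)) ^ 2 * a k) * 64))) ≤ CPs := fun k =>
    max_le_max le_rfl (by nlinarith [mul_le_mul_of_nonneg_left (hac k) (Nat.cast_nonneg (α := ℝ) d)])
  have hCPs0 : 0 ≤ CPs := le_max_of_le_left (by norm_num)
  have hLG0 : ∀ k W, 0 ≤ ScV (L ^ k) M (Rlev L M R' k) (landauG (fine (L ^ k) M) 1 (Rlev L M R' k)) W :=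
    fun k W => ScV_nonneg (L ^ k) M _ (landauG_nonneg zero_le_one _) W
  -- coarse V-UB ∕ V-P for the Landau form (part 3 §1), weakened to the uniform constants
  have hUBc : ∀ k (φ : Tor M → Fin d → ℂ), ∃ W, QvL (L ^ k) M (nestLv L M R' k) W = φ ∧
      ScV (L ^ k) M (Rlev L M R' k) (landauG (fine (L ^ k) M) 1 (Rlev L M R' k)) W ≤ Λs * nsqV M φ := fun k φ => by
    obtain ⟨W, hW, hS⟩ := hUBc_landau_nestLv L M hU hb hcoh hd k (ha0 k) (ha k) (hcUB k) one_pos φ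
    exact ⟨W, hW, hS.trans (mul_le_mul_of_nonneg_right (hΛk' k) (nsqV_nonneg M φ))⟩
  have hPc : ∀ k W, qWV (L ^ k) M W
      ≤ CPs * (ScV (L ^ k) M (Rlev L M R' k) (landauG (fine (L ^ k) M) 1 (Rlev L M R' k)) W + nsqV M (QvL (L ^ k) M (nestLv L M R' k) W)) := fun k W => by
    have h := hPc_landau_nestLv L M hU hb hcoh hM2 k (ha0 k) (ha k) (hsmallP k) (hγs k) (hsmall80 k) one_pos W
    exact h.trans (mul_le_mul_of_nonneg_right (hCPk k) (add_nonneg (hLG0 k W) (nsqV_nonneg M _)))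
  -- V-REG at every level (leaf-03-g5's near-line V-REG; frames the straight level-`k` taxi, `hnear` := (E_k))
  have hREG : ∀ k (φ : Tor M → Fin d → ℂ) W, QvL (L ^ k) M (nestLv L M R' k) W = φ →
      (∀ W₂, QvL (L ^ k) M (nestLv L M R' k) W₂ = φ →
        ScV (L ^ k) M (Rlev L M R' k) (landauG (fine (L ^ k) M) 1 (Rlev L M R' k)) W ≤ ScV (L ^ k) M (Rlev L M R' k) (landauG (fine (L ^ k) M) 1 (Rlev L M R' k)) W₂) →
      rhoV (L ^ k) M (Rlev L M R' k) W ≤ (4 * Λs + 1 / 2) * (ScV (L ^ k) M (Rlev L M R' k) (landauG (fine (L ^ k) M) 1 (Rlev L M R' k)) W + nsqV M φ) :=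
    fun k φ W hW hmin => by
    have hUk : ∀ x μ, Rlev L M R' k x μ ∈ unitary (ℂ →L[ℂ] ℂ) := Rlev_mem_unitary L M hU k
    have hw := inBlock_blockOf_of_bpt (L ^ k) M hM2
      (P := fun x μ => ‖Rlev L M R' k x μ * star (taxiTv (L ^ k) M (Rlev L M R' k) (x + unitVec (fine (L ^ k) M) μ)) * taxiTv (L ^ k) M (Rlev L M R' k) x - 1‖
        ≤ ((d - 1 : ℕ) : ℝ) * ((L ^ k - 1 : ℕ) : ℝ) * a k)
      (fun y j μ hj => inBlock_defect_taxiTv_adjoint_le (L ^ k) M hUk (ha k) y j μ hj)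
    have h := hREG_rhoV_landau_near (L ^ k) M hUk (taxiTv_mem_unitary (L ^ k) M hUk) hw (by simpa only [Nat.cast_pow] using hsmallP k) (ha0 k)
      (fun x μ ν => ha k x μ ν) (by simpa only [Nat.cast_pow] using hsmallp k) (norm_nestLv_le_one L M hR' k) (nestLv_sub_lineT_le L M hR' hb hcoh k) (hγs k)
      (hΛk0 k) (hUBc_landau_nestLv L M hU hb hcoh hd k (ha0 k) (ha k) (hcUB k) one_pos) φ W hW hmin
    have hS0' : 0 ≤ ScV (L ^ k) M (Rlev L M R' k) (landauG (fine (L ^ k) M) 1 (Rlev L M R' k)) W + nsqV M φ :=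
      add_nonneg (hLG0 k W) (nsqV_nonneg M φ)
    exact h.trans (mul_le_mul_of_nonneg_right (by linarith [hΛk' k]) hS0')
  exact effV_tendsto_of_upper_geom L M (Rlev L M R') R' (fun k => KLandau (fine (L ^ k) M) 1 (Rlev L M R' k))
    (fun k => landauG (fine (L ^ k) M) 1 (Rlev L M R' k)) (fun k => landauG (fine L (fine (L ^ k) M)) 1 (R' k)) (nestLv L M R')
    (fun k => lineT L (fine (L ^ k) M) (taxiTv L (fine (L ^ k) M) (R' k)) (R' k)) (fun k => KLandau_posSemidef (fine (L ^ k) M) zero_le_one _)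
    (fun k W => landauG_eq_qform (fine (L ^ k) M) 1 _ W) (fun k => rfl) (fun k => rfl) (fun k => landauG_hGtr L M (Rlev L M R') R' (fun k => rfl) 1 k) haa
    (fun _ => Λs) (fun _ => CPs) (fun _ => 4 * Λs + 1 / 2) ε₁ δ' (fun _ => hΛs0) (fun _ => le_rfl) (fun _ => hCPs0) (fun _ => le_rfl)
    (fun _ => by positivity) (fun _ => le_rfl) hε₁ hδ' hθ hθ1 hεθ hδ'θ (fun k W => rhoV_nonneg (L ^ k) M _ W) hUBc hPc hONEm hREG

end Landau

end Summit.QuantumFields.BalabanUV.T4Continuum.VariationalColourTaxiTransport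

end
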